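import Literature.MathematicalPhysics.QuantumFieldTheory.Balaban1983to89.B13ChainJointNonvacuity
import Literature.MathematicalPhysics.QuantumFieldTheory.Balaban1983to89.B13NodeTorusFamilyNonvacuity
import Literature.MathematicalPhysics.QuantumFieldTheory.Balaban1983to89.B13Bound226Numerals

/-!
# `Balaban1983to89.B13ChainJointNonvacuity226` — T. Bałaban, *Renormalization group approach to lattice gauge field
theories. II. Cluster expansions*, Commun. Math. Phys. **116** (1988) 1–22, doi:10.1007/bf01239022 [Balaban1988RG2Cluster]:
**THE JOINT NON-VACUITY WITNESS ONE STOREY UP** — the 69 numerical conjuncts of the N10 torus chain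
(`B13ChainJointNonvacuity.chain_joint_nonvacuous`: print's `q = 8`, R12 p. 16, the Lemma-1 ∕ leaf thresholds, the 41 Lemma-3
conjuncts), the bundled `Lemma3Numerics` of the junction's `hN`, the (2.18) bound of its `hτ2`, **AND** the three located numerals of
`B13Bound226Numerals` (the (2.24)–(2.26) smallness of the junction: `θ₀ ≤ θ₀max`, `γ₂ ≤ γ₂max`, `M⁴min ≤ M⁴`) **AND** the (2.22)∕p. 17
constant matching `hPa : a ≤ γ₂·r_P²` at `r_P = ε₁∕‖g‖`, met SIMULTANEOUSLY — for EVERY choice of the NODE-A letters — by ONE constants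
record, ONE `θ₀ > 0`, ONE `γ₂ > 0` and ONE non-zero coupling `g`

statement-level skeleton of published theorems with citation tags; proofs where landed; nothing here is a claim about the
Yang–Mills mass gap

CITATION HEADER (verbatim).  p. 16 [PDF 16], after (2.18): *"We assume that ⅛(κ₁ − 1) ≧ (1 − 3δ)κ, C₃ ≦ E₀C₁, and q ≧ 8."*;
p. 17 [PDF 17], after (2.24): *"Of course we have assumed that α₅ is sufficiently small, e.g. α₅‖C^{(k)}(Z₀,0)‖ < ½."* (the «½» is a
stacked glyph the text layer garbles; settled from the page image by lit-balaban r10, bus l.24672); p. 21 [PDF 21]: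
*"The assumptions allow finally us to fix all the constants, or rather bounds on these constants."*  NOT PRINTED: every explicit number
below — they are WITNESS DATA for typed hypothesis lists, not Bałaban's constants.

WHY THIS FILE (cell `pub-ymgap`, HUMAN RULING D-0062 Track A ∕ D-0149 width seats, node N10 = [B13], seat `pub-ymgap-dag-n10-w1`, the
lane owner's W-WAVE-2 word «(α) GO», bus l.24492).  Director's STANDING A6 RULE (№189): a junction whose binders are hypotheses about
hidden objects ships a joint satisfiability witness of its NUMERICAL binders or is graded «A6-UNCHECKED».  The tree holds two halves:
`chain_joint_nonvacuous` (the chain's 69 numeric conjuncts at ONE record, n10-b) and `B13Bound226Numerals` (the (2.24)–(2.26) smallness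
as three located numerals, this seat).  They share the record's `α₄, M, κ₁` (through `M⁴min ≤ M⁴`) and, through p. 17's `a ≤ γ₂r_P²` with
`r_P = ε₁∕‖g‖`, the record's `ε₁` and the chain's rate `a = aw`: a JOINT inhabitant is a statement about ONE record.  The `∃` of
`chain_joint_nonvacuous` hides its witness's fields (`c.M`, `c.α₄`, `c.κ₁` are not exported), and the joint condition `M⁴min(…, m′, c.α₄,
c.κ₁) ≤ c.M⁴` must hold for EVERY letter choice (`m′ ≥ 1` unbounded) — so the record has to be NAMED, with `M` free to grow.

WHAT THIS FILE DOES.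
§1 `constsQ8 M` — the chain's `q = 8` record AS A FAMILY IN `M`: `B13Lemma3TorusNonvacuity.consts` (L = 8, δ = 3∕40, κ = κw, κ₁ = κ₁t,
   δ₀ = 1, E₀ = 2, C₁ = α₄ = 1) with `q := 8`, `C₂ := 50`, `M := M`, `ε₁ := ε₁t·M⁻⁸·e^{−49κ₁t}`; its member `M = κw + 1` IS the (unexported)
   witness of `chain_joint_nonvacuous` verbatim.  ★ `constsQ8_spec (hM : κw + 1 ≤ M)`: the SAME 69 conjuncts, in the same order and shapes,
   for every member — proof ADAPTED FROM n10-b's `chain_joint_nonvacuous` (credit: seat `pub-ymgap-dag-n10-b`): the three products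
   `ε₁·K₀`, `C3act·ε₁`, `1∕|τ|` through which `ε₁` and `M` enter the 41 Lemma-3 conjuncts are `M`-FREE by that design (`M⁸·M⁻⁸ = 1`), so the
   41 transfer VERBATIM from `numerics_nonvacuous_pos_consts`, the Lemma-1 thresholds from `B13NodeTorusConsts.consts_meets_lemma1_thresholds`,
   and the only `M`-monotone conjuncts (`1 ≤ M`, `10e⁻¹ ≤ δ₀M`, `2 log 5 ≤ δ₀M`, R24sharp `κ + 1 ≤ δ₀M`) follow from `M ≥ κw + 1`.
   `constsQ8_numerics` (the junction's `hN` shape `Lemma3Numerics c 1 (c.L∕2) aw 1 1 ½ 1`), `constsQ8_invTau_zero` (the junction's `hτ2`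
   shape); an `example` re-obtains n10-b's `∃`-statement at `M = κw + 1` (cross-check of the shapes, nothing declared).
§2 ★★ `chain_joint_nonvacuous_226`: for ALL `m ν m′ : ℕ` and ALL signed NODE-A letters `κ⋆ > 0`, `K_G, K_Cs, c_E, c_V, c₀η ≥ 0`, `m_A > 0`
   there are `c` (:= `constsQ8 (κw + 1 + M⁴min)`), `θ₀ := θ₀max > 0`, `γ₂ := γ₂max > 0`, `g := ε₁∕√(aw∕γ₂) ≠ 0` meeting AT ONCE: the 69
   conjuncts · `Lemma3Numerics c 1 (c.L∕2) aw 1 1 ½ 1` · `E₀ε₁C₁α₄⁻¹M^q e^{C₂κ₁} ≤ ½` · `0 < θ₀ ≤ θ₀max` · `0 < γ₂ ≤ γ₂max` · `1 ≤ c.M`,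
   `M⁴min(…, c.α₄, c.κ₁) ≤ c.M⁴` · `g ≠ 0`, `aw ≤ γ₂·(c.ε₁∕‖g‖)²` (the junction's `hPa` at `r_P = ε₁∕‖g‖`, with equality) · AND the eleven
   binder shapes `hkap'' hk1 hk2 hk3 hk4 hθ₀le hθR1le hsmallKθ hc0 hαc hsmall` of the junction on the canonical chain at the record's own
   `α₄, M, κ₁` (by `B13Bound226Numerals.numerals_226`).

HONEST SCOPE.  «Numerics of the chain + the (2.24)–(2.26) located numerals + (2.22)'s `a ≤ γ₂r_P²` jointly consistent AS TYPED, for every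
choice of the NODE-A letters; nothing about Bałaban's constants» (the lane owner's label).  The Lemma 1–2 located inputs of the junction
(`K K′ K₂ m₂ θ₁`, `hC`, `hfloor`) and NODE A's operator block have their own witnesses (`B13NodeTorusConsts.leaf_at_consts`,
`B13Bound226Witness*`, `B13EntrywiseBlockWitness`); a single inhabitant of all ≈ 160 binders of the junction is NOT claimed.  One
transparent `def` (the record family), no structure ∕ instance ∕ notation ∕ new named fact (D-0026); n10-b's files are imported UNCHANGED.
Count-neutral; N10 NOT discharged; one finite four-torus programme at fixed ε; nothing continuum ∕ ℝ⁴ ∕ OS ∕ mass-gap ∕ Clay.  No `sorry`.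
-/

noncomputable section

namespace Literature.MathematicalPhysics.QuantumFieldTheory.Balaban1983to89.B13ChainJointNonvacuity226

open Literature.MathematicalPhysics.QuantumFieldTheory.Balaban1983to89
open Literature.MathematicalPhysics.QuantumFieldTheory.Balaban1983to89.B12TreeDecay (kappa₀ K₀ K₀_pos kappa₀_nonneg)
open Literature.MathematicalPhysics.QuantumFieldTheory.Balaban1983to89.B13Bound143 (invTau R12)
open Literature.MathematicalPhysics.QuantumFieldTheory.Balaban1983to89.B13Lemma3WindowNonvacuity
  (Kw κ₀w κw δw μw α₆w Aup A₁w A₂w ε₂w aw)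
open Literature.MathematicalPhysics.QuantumFieldTheory.Balaban1983to89.B13Lemma3TorusNonvacuity
  (κ₁t ε₁t consts numerics_nonvacuous_pos_consts)
open Literature.MathematicalPhysics.QuantumFieldTheory.Balaban1983to89.B13NodeTorusConsts (consts_meets_lemma1_thresholds)
open Literature.MathematicalPhysics.QuantumFieldTheory.Balaban1983to89.B13Lemma3TorusSocket (Lemma3Numerics)
open Literature.MathematicalPhysics.QuantumFieldTheory.Balaban1983to89.B13NodeTorusFamilyNonvacuity (aw_pos)
open Literature.MathematicalPhysics.QuantumFieldTheory.Balaban1983to89.B13Bound226Numerals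
  (chainRate theta theta0Max gamma2Max m4Min theta0Max_pos gamma2Max_pos m4Min_nonneg numerals_226)

/-! ## §1. The chain's `q = 8` constants record as a family in `M`, and its 69 conjuncts -/

/-- WITNESS DATA (the one definition of this file). The `q = 8` record of the N10 torus chain AS A FAMILY IN THE BLOCK CONSTANT `M`:
lit-balaban's `B13Lemma3TorusNonvacuity.consts` with `q := 8`, `C₂ := 50`, `M := M` and `ε₁ := ε₁t·M⁻⁸·e^{−49κ₁t}` (print's order of
choices, p. 21: `ε₁` last, so that `ε₁M^q e^{C₂κ₁}` does not move).  The member `M = κw + 1` is the witness inside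
`B13ChainJointNonvacuity.chain_joint_nonvacuous`. [cite: Balaban1988RG2Cluster, p.16 (after (2.18)) and p.21 (closing paragraph)] -/
def constsQ8 (M : ℝ) : B13.Consts where
  L := 8
  q := 8
  M := M
  κ := κw
  κ₁ := κ₁t
  δ := δw
  δ₀ := 1
  E₀ := 2
  ε₁ := ε₁t * (M ^ 8)⁻¹ * Real.exp (-(49 * κ₁t))
  C₁ := 1
  C₂ := 50
  C₃ := 1
  α₀ := 1
  α₁ := 1
  α₄ := 1
  α₅ := 1
  α₆ := α₆w
  γ₂ := 1
  γ := 1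
  A₁ := A₁w
  A₂ := A₂w

/-- The fields of `constsQ8 M` a consumer reads by name: `M`, `q = 8`, `L = 8`, `α₄ = 1`, `κ₁ = κ₁t`, `δ₀ = 1`, `κ = κw`, `ε₁`
(definitional). [cite: Balaban1988RG2Cluster, p.21 (closing paragraph)] -/
theorem constsQ8_fields (M : ℝ) :
    (constsQ8 M).M = M ∧ (constsQ8 M).q = 8 ∧ (constsQ8 M).L = 8 ∧ (constsQ8 M).α₄ = 1 ∧ (constsQ8 M).κ₁ = κ₁t ∧
      (constsQ8 M).δ₀ = 1 ∧ (constsQ8 M).κ = κw ∧ (constsQ8 M).ε₁ = ε₁t * (M ^ 8)⁻¹ * Real.exp (-(49 * κ₁t)) :=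
  ⟨rfl, rfl, rfl, rfl, rfl, rfl, rfl, rfl⟩

/-- `0 ≤ κw` and `1280 ≤ κw` (so every member `M ≥ κw + 1` has `M ≥ 1281`). [folklore] -/
theorem κw_lower : 0 ≤ κw ∧ 1280 ≤ κw := by
  have hκ₀nn : 0 ≤ κ₀w := kappa₀_nonneg (by norm_num) 8
  have hκw : κw = 20 * (κ₀w + 64) := rfl
  constructor <;> · rw [hκw]; linarith

/-- `0 < ε₁` on the family, for `M > 0`. [cite: Balaban1988RG2Cluster, p.21 (closing paragraph)] -/
theorem constsQ8_ε₁_pos {M : ℝ} (hM0 : 0 < M) : 0 < (constsQ8 M).ε₁ := by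
  have hKw : 0 < Kw := K₀_pos 64 8
  have hα₆ : 0 < α₆w := by unfold α₆w; positivity
  have hAup : 0 < Aup := by unfold Aup; positivity
  have hA₁ : 0 < A₁w := by unfold A₁w; positivity
  have hA₂ : 0 < A₂w := by unfold A₂w; positivity
  have hε₂ : 0 < ε₂w := by unfold ε₂w; positivity
  have hε₁t : 0 < ε₁t := by unfold ε₁t; positivity
  show 0 < ε₁t * (M ^ 8)⁻¹ * Real.exp (-(49 * κ₁t))
  positivity

/-- **THE 69 CONJUNCTS OF THE CHAIN ON THE WHOLE FAMILY** (the statement of `B13ChainJointNonvacuity.chain_joint_nonvacuous` VERBATIM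
at `c := constsQ8 M`, every `M ≥ κw + 1`): (A) the bridge ∕ producer numbers (print's `q = 8`, R12), (B) the 16 Lemma-1 ∕ leaf thresholds,
(C) the 41 Lemma-3 conjuncts.  Proof adapted from n10-b's `chain_joint_nonvacuous`: the products `ε₁K₀`, `C3act·ε₁`, `1∕|τ|` are
`M`-free, so (C) transfers from `numerics_nonvacuous_pos_consts` and (B) from `consts_meets_lemma1_thresholds`; `M` itself only has to
exceed `κw + 1` (`1 ≤ M`, `10e⁻¹ ≤ δ₀M`, `2 log 5 ≤ δ₀M`, R24sharp). [cite: Balaban1988RG2Cluster, p.16 (after (2.18)) and p.21 (closing paragraph)] -/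
theorem constsQ8_spec {M : ℝ} (hM : κw + 1 ≤ M) :
    -- (A) the bridge / producer numbers
    ((constsQ8 M).q = 8 ∧ R12 (constsQ8 M) ∧ 11 / 3 ≤ (constsQ8 M).κ₁ ∧ 1 + 4 * Real.log 162 ≤ (constsQ8 M).κ₁ ∧
      64 * Real.log 162 ≤ (constsQ8 M).δ * (constsQ8 M).κ ∧ 1 ≤ (constsQ8 M).M ∧
      0 < (constsQ8 M).E₀ ∧ 0 < (constsQ8 M).ε₁ ∧ 0 < (constsQ8 M).C₁ ∧ 0 < (constsQ8 M).α₄ ∧ 0 ≤ (constsQ8 M).C₃ ∧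
      27 * 1 * (constsQ8 M).C₁ ^ 3 * Real.exp (49 * (constsQ8 M).κ₁ - 1) ≤ (constsQ8 M).C₃ * Real.exp ((constsQ8 M).C₂ * (constsQ8 M).κ₁)) ∧
    -- (B) the Lemma-1 / leaf thresholds
    ((constsQ8 M).L = 8 ∧ 12 ≤ (constsQ8 M).L * 2 ∧ kappa₀ 64 8 ≤ (constsQ8 M).κ ∧ kappa₀ 64 8 ≤ (constsQ8 M).δ * (constsQ8 M).κ ∧
      0 ≤ (constsQ8 M).κ ∧ (constsQ8 M).δ < 1 ∧ 1 ≤ (constsQ8 M).δ * (constsQ8 M).κ ∧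
      1 + 2 * Real.log (8 * 12 ^ 3) ≤ (constsQ8 M).κ₁ ∧ 2 + 16 * Real.log 128 ≤ (constsQ8 M).κ₁ ∧
      10 * Real.exp (-1) ≤ (constsQ8 M).δ₀ * (constsQ8 M).M ∧ 2 * Real.log 5 ≤ (constsQ8 M).δ₀ * (constsQ8 M).M ∧
      (1 - (constsQ8 M).δ) * (constsQ8 M).κ ≤ (1 / 4) * ((constsQ8 M).κ₁ - 1) ∧
      (1 - 2 * (constsQ8 M).δ) * (constsQ8 M).κ ≤ (1 / 16) * (constsQ8 M).κ₁ ∧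
      0 < (constsQ8 M).E₀ * (constsQ8 M).ε₁ * (constsQ8 M).C₁ * (constsQ8 M).M ^ (constsQ8 M).q *
        Real.exp ((constsQ8 M).C₂ * (constsQ8 M).κ₁) ∧ 0 ≤ (constsQ8 M).ε₁ ∧ 0 ≤ (constsQ8 M).C₃) ∧
    -- (C) the 41 Lemma-3 conjuncts
    (8 ≤ (constsQ8 M).L ∧ 0 < (1 : ℕ) ∧ 0 < (constsQ8 M).ε₁ ∧ 0 < (constsQ8 M).α₆ ∧ 0 ≤ (constsQ8 M).eps2 ∧ 0 ≤ (constsQ8 M).δ ∧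
      0 ≤ 1 - 7 * (constsQ8 M).δ ∧ 0 ≤ (constsQ8 M).κ ∧ 0 ≤ aw ∧
      (constsQ8 M).R15 ∧ 18 * ((1 - 4 * (constsQ8 M).δ) * (constsQ8 M).κ) ≤ aw / 20 ∧ 4 * (constsQ8 M).κ ≤ aw / 20 ∧
      Real.exp (-(aw / 20)) ≤ (constsQ8 M).eps2 ∧
      2 * (4 : ℝ) * ((1 : ℕ) : ℝ) ^ 4 * Real.exp (-(aw / 10)) ≤ aw / 20 ∧
      0 ≤ (1 : ℝ) ∧ kappa₀ 64 8 + 1 ≤ (constsQ8 M).δ * (constsQ8 M).κ ∧ (constsQ8 M).α₆ * Real.exp 1 * K₀ 64 8 * 64 ≤ 1 ∧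
      Real.exp (-(aw / 20)) * 64 ≤ (constsQ8 M).δ * (constsQ8 M).κ ∧
      B13Step237.R18half (constsQ8 M) (K₀ 64 8 * Real.exp (Real.exp (-(aw / 20)) * 64)) ∧
      B13Step237.R18sharp (constsQ8 M) (K₀ 64 8 * Real.exp (Real.exp (-(aw / 20)) * 64)) (((constsQ8 M).L : ℝ) / 2) ∧
      0 ≤ (1 : ℝ) ∧ kappa₀ 64 8 + 1 ≤ (constsQ8 M).δ * (((constsQ8 M).L : ℝ) / 2) * (constsQ8 M).κ ∧
      (constsQ8 M).α₆ * Real.exp 1 * K₀ 64 8 * 64 ≤ 1 ∧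
      18 * ((1 - 7 * (constsQ8 M).δ) * (((constsQ8 M).L : ℝ) / 2) * (constsQ8 M).κ) ≤ ((constsQ8 M).κ₁ - 1) / 2 ∧
      (0 : ℝ) ≤ 1 / 2 ∧ 1 / 2 + Real.exp (-(((constsQ8 M).κ₁ - 1) / 2)) ≤ 1 ∧
      1 * 64 ≤ (constsQ8 M).δ * (((constsQ8 M).L : ℝ) / 2) * (constsQ8 M).κ ∧
      B13Step237.bracketF (constsQ8 M) (K₀ 64 8 * Real.exp (Real.exp (-(aw / 20)) * 64)) / (constsQ8 M).α₆ * Real.exp (1 * 64) ≤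
        (constsQ8 M).C3act * (constsQ8 M).ε₁ ∧
      0 ≤ (constsQ8 M).C3act * (constsQ8 M).ε₁ ∧
      (constsQ8 M).κ + 2 * (64 * Real.log 162) + 2 ≤ (1 - 8 * (constsQ8 M).δ) * (((constsQ8 M).L : ℝ) / 2) * (constsQ8 M).κ ∧
      (constsQ8 M).C3act * (constsQ8 M).ε₁ * Real.exp (5 * (constsQ8 M).κ + 1) * K₀ 64 8 * 9 * 64 ≤ 1 ∧
      Real.exp 1 * 9 * 64 * K₀ 64 8 ^ 2 ≤ (constsQ8 M).A₂ ∧ (constsQ8 M).R22 ∧ (constsQ8 M).R23 ∧ (constsQ8 M).R24sharp ∧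
      0 ≤ (constsQ8 M).E₀ ∧
      0 ≤ (1 / 64 : ℝ) ∧ 1 / 64 * 64 ≤ (constsQ8 M).E₀ / 2 ∧
      (0 : ℝ) < 1 / 2 ∧ 1 ≤ (constsQ8 M).κ₁ ∧
      (∀ d : ℝ, 0 ≤ d → 0 < invTau (constsQ8 M) d ∧ invTau (constsQ8 M) d ≤ 1 / 2)) := by
  -- adapted from `B13ChainJointNonvacuity.chain_joint_nonvacuous` (seat pub-ymgap-dag-n10-b): the witness `c8` there is `constsQ8 (κw + 1)`
  -- elementary facts about the base witness
  have hκ₀ : κ₀w = 64 * Real.log 162 := by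
    have h := TreeLengthCubeSystem.kappa₀_four
    show kappa₀ 64 8 = 64 * Real.log 162
    norm_num at h
    exact h
  have hκ₀nn : 0 ≤ κ₀w := kappa₀_nonneg (by norm_num) 8
  have hκw : κw = 20 * (κ₀w + 64) := rfl
  have hκw1280 : 1280 ≤ κw := by rw [hκw]; linarith
  have hμ : μw = (19 / 10) * κw := by show (1 - 7 * δw) * 4 * κw = _; unfold δw; ring
  have hκ₁t : κ₁t = 1 + 36 * μw := rfl
  have hM0 : 0 < M := by linarith
  have hM1 : (1 : ℝ) ≤ M := by linarith
  have hε₁' : 0 < ε₁t * (M ^ 8)⁻¹ * Real.exp (-(49 * κ₁t)) := constsQ8_ε₁_pos hM0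
  -- the three invariant products (`M`-free by design)
  have hkey : ε₁t * (M ^ 8)⁻¹ * Real.exp (-(49 * κ₁t)) * M ^ 8 * Real.exp (50 * κ₁t) =
      ε₁t * (κw + 1) ^ 0 * Real.exp (1 * κ₁t) := by
    have h8 : (M ^ 8)⁻¹ * M ^ 8 = 1 := inv_mul_cancel₀ (by positivity)
    have he : Real.exp (-(49 * κ₁t)) * Real.exp (50 * κ₁t) = Real.exp (1 * κ₁t) := by
      rw [← Real.exp_add]; congr 1; ring
    calc ε₁t * (M ^ 8)⁻¹ * Real.exp (-(49 * κ₁t)) * M ^ 8 * Real.exp (50 * κ₁t)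
        = ε₁t * ((M ^ 8)⁻¹ * M ^ 8) * (Real.exp (-(49 * κ₁t)) * Real.exp (50 * κ₁t)) := by ring
      _ = ε₁t * (κw + 1) ^ 0 * Real.exp (1 * κ₁t) := by rw [h8, he]; ring
  have hK₀ε : (constsQ8 M).ε₁ * (constsQ8 M).K₀ = consts.ε₁ * consts.K₀ := by
    show ε₁t * (M ^ 8)⁻¹ * Real.exp (-(49 * κ₁t)) *
        (2 * 1 * (1 : ℝ)⁻¹ * α₆w⁻¹ * M ^ 8 * Real.exp (50 * κ₁t)) =
      ε₁t * (2 * 1 * (1 : ℝ)⁻¹ * α₆w⁻¹ * (κw + 1) ^ 0 * Real.exp (1 * κ₁t))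
    calc ε₁t * (M ^ 8)⁻¹ * Real.exp (-(49 * κ₁t)) *
          (2 * 1 * (1 : ℝ)⁻¹ * α₆w⁻¹ * M ^ 8 * Real.exp (50 * κ₁t))
        = (2 * 1 * (1 : ℝ)⁻¹ * α₆w⁻¹) *
            (ε₁t * (M ^ 8)⁻¹ * Real.exp (-(49 * κ₁t)) * M ^ 8 * Real.exp (50 * κ₁t)) := by ring
      _ = (2 * 1 * (1 : ℝ)⁻¹ * α₆w⁻¹) * (ε₁t * (κw + 1) ^ 0 * Real.exp (1 * κ₁t)) := by rw [hkey]
      _ = _ := by ring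
  have hE : (constsQ8 M).eps2 = consts.eps2 := by
    show (constsQ8 M).E₀ * (constsQ8 M).ε₁ * (constsQ8 M).K₀ = consts.E₀ * consts.ε₁ * consts.K₀
    rw [mul_assoc, hK₀ε, ← mul_assoc]
    rfl
  have hCE : (constsQ8 M).C3act * (constsQ8 M).ε₁ = consts.C3act * consts.ε₁ := by
    show 2 * (((constsQ8 M).L : ℝ) + 2) ^ 4 * (constsQ8 M).A₁ * ((constsQ8 M).E₀ * (constsQ8 M).K₀) * (constsQ8 M).ε₁ =
      2 * ((consts.L : ℝ) + 2) ^ 4 * consts.A₁ * (consts.E₀ * consts.K₀) * consts.ε₁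
    have h1 : 2 * (((constsQ8 M).L : ℝ) + 2) ^ 4 * (constsQ8 M).A₁ * ((constsQ8 M).E₀ * (constsQ8 M).K₀) * (constsQ8 M).ε₁ =
        2 * (((constsQ8 M).L : ℝ) + 2) ^ 4 * (constsQ8 M).A₁ * (constsQ8 M).E₀ * ((constsQ8 M).ε₁ * (constsQ8 M).K₀) := by ring
    rw [h1, hK₀ε]
    show 2 * ((consts.L : ℝ) + 2) ^ 4 * consts.A₁ * consts.E₀ * (consts.ε₁ * consts.K₀) = _
    ring
  have hI : ∀ d : ℝ, invTau (constsQ8 M) d = invTau consts d := by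
    intro d
    show (constsQ8 M).E₀ * (constsQ8 M).ε₁ * (constsQ8 M).C₁ * (constsQ8 M).α₄⁻¹ * (constsQ8 M).M ^ (constsQ8 M).q *
          Real.exp ((constsQ8 M).C₂ * (constsQ8 M).κ₁) * Real.exp (-(1 - 3 * (constsQ8 M).δ) * (constsQ8 M).κ * d) =
      consts.E₀ * consts.ε₁ * consts.C₁ * consts.α₄⁻¹ * consts.M ^ consts.q * Real.exp (consts.C₂ * consts.κ₁) *
        Real.exp (-(1 - 3 * consts.δ) * consts.κ * d)
    show 2 * (ε₁t * (M ^ 8)⁻¹ * Real.exp (-(49 * κ₁t))) * 1 * (1 : ℝ)⁻¹ * M ^ 8 *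
        Real.exp (50 * κ₁t) * Real.exp (-(1 - 3 * δw) * κw * d) =
      2 * ε₁t * 1 * (1 : ℝ)⁻¹ * (κw + 1) ^ 0 * Real.exp (1 * κ₁t) * Real.exp (-(1 - 3 * δw) * κw * d)
    calc 2 * (ε₁t * (M ^ 8)⁻¹ * Real.exp (-(49 * κ₁t))) * 1 * (1 : ℝ)⁻¹ * M ^ 8 *
          Real.exp (50 * κ₁t) * Real.exp (-(1 - 3 * δw) * κw * d)
        = 2 * 1 * (1 : ℝ)⁻¹ * Real.exp (-(1 - 3 * δw) * κw * d) *
            (ε₁t * (M ^ 8)⁻¹ * Real.exp (-(49 * κ₁t)) * M ^ 8 * Real.exp (50 * κ₁t)) := by ring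
      _ = 2 * 1 * (1 : ℝ)⁻¹ * Real.exp (-(1 - 3 * δw) * κw * d) * (ε₁t * (κw + 1) ^ 0 * Real.exp (1 * κ₁t)) := by
          rw [hkey]
      _ = _ := by ring
  have hmem : ∀ A : ℝ, B13Step237.memberF (constsQ8 M) A = B13Step237.memberF consts A := by
    intro A
    show (((constsQ8 M).L : ℝ) + 2) ^ 4 * A * (constsQ8 M).eps2 = ((consts.L : ℝ) + 2) ^ 4 * A * consts.eps2
    rw [hE]
    rfl
  have hbr : ∀ A : ℝ, B13Step237.bracketF (constsQ8 M) A = B13Step237.bracketF consts A := by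
    intro A
    show 2 * B13Step237.memberF (constsQ8 M) A = 2 * B13Step237.memberF consts A
    rw [hmem]
  -- the two source bundles (n10-b's and lit-balaban's witnesses, BY NAME)
  obtain ⟨l1, l2, l3, l4, l5, l6, l7, l8, l9, l10, l11, l12, l13, -, -, l16⟩ := consts_meets_lemma1_thresholds
  obtain ⟨n1, n2, -, n4, n5, n6, n7, n8, n9, n10, n11, n12, n13, n14, n15, n16, n17, n18, n19, n20, n21, n22, n23, n24,
    n25, n26, n27, n28, n29, n30, n31, n32, n33, n34, -, n36, n37, n38, n39, n40, n41⟩ := numerics_nonvacuous_pos_consts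
  refine ⟨?_, ?_, ?_⟩
  · -- (A)
    refine ⟨rfl, ?_, ?_, ?_, ?_, hM1, ?_, hε₁', ?_, ?_, ?_, ?_⟩
    · -- R12
      refine ⟨?_, ?_, ?_⟩
      · show (1 - 3 * δw) * κw ≤ (κ₁t - 1) / 8
        rw [hκ₁t, hμ]; unfold δw; linarith
      · show (1 : ℝ) ≤ 2 * 1; norm_num
      · show 8 ≤ 8; exact le_rfl
    · show (11 : ℝ) / 3 ≤ κ₁t; rw [hκ₁t, hμ]; linarith
    · show 1 + 4 * Real.log 162 ≤ κ₁t
      have hlog : Real.log 162 ≤ 162 := by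
        have := Real.log_le_sub_one_of_pos (show (0 : ℝ) < 162 by norm_num); linarith
      rw [hκ₁t, hμ]; linarith
    · show 64 * Real.log 162 ≤ δw * κw
      rw [← hκ₀, hκw]; unfold δw; linarith
    · show (0 : ℝ) < 2; norm_num
    · show (0 : ℝ) < 1; norm_num
    · show (0 : ℝ) < 1; norm_num
    · show (0 : ℝ) ≤ 1; norm_num
    · -- the T7 floor at C₃′ = 1: 27·e^{49κ₁−1} ≤ e^{50κ₁}
      show 27 * 1 * (1 : ℝ) ^ 3 * Real.exp (49 * κ₁t - 1) ≤ 1 * Real.exp (50 * κ₁t)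
      have h27 : (27 : ℝ) ≤ Real.exp (κ₁t + 1) := by
        have := Real.add_one_le_exp (κ₁t + 1)
        have hk : (26 : ℝ) ≤ κ₁t := by rw [hκ₁t, hμ]; linarith
        linarith
      have hsplit : 1 * Real.exp (50 * κ₁t) = Real.exp (κ₁t + 1) * Real.exp (49 * κ₁t - 1) := by
        rw [one_mul, ← Real.exp_add]; congr 1; ring
      rw [hsplit]
      have hpos : 0 ≤ Real.exp (49 * κ₁t - 1) := (Real.exp_pos _).le
      calc 27 * 1 * (1 : ℝ) ^ 3 * Real.exp (49 * κ₁t - 1) = 27 * Real.exp (49 * κ₁t - 1) := by ring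
        _ ≤ Real.exp (κ₁t + 1) * Real.exp (49 * κ₁t - 1) := mul_le_mul_of_nonneg_right h27 hpos
  · -- (B): thirteen thresholds are the base witness's own; the two `δ₀M` floors are monotone in `M`
    have l10' : 10 * Real.exp (-1) ≤ 1 * (κw + 1) := l10
    have l11' : 2 * Real.log 5 ≤ 1 * (κw + 1) := l11
    refine ⟨l1, l2, l3, l4, l5, l6, l7, l8, l9, ?_, ?_, l12, l13, ?_, hε₁'.le, l16⟩
    · show 10 * Real.exp (-1) ≤ 1 * M; linarith
    · show 2 * Real.log 5 ≤ 1 * M; linarith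
    · show (0 : ℝ) < 2 * (ε₁t * (M ^ 8)⁻¹ * Real.exp (-(49 * κ₁t))) * 1 * M ^ 8 * Real.exp (50 * κ₁t)
      positivity
  · -- (C): the 41 conjuncts transfer through the invariant products; R24sharp `κ + 1 ≤ δ₀M` is monotone in `M`
    refine ⟨n1, n2, hε₁', n4, ?_, n6, n7, n8, n9, ?_, n11, n12, ?_, n14, n15, n16, n17, n18, ?_, ?_, n21, n22, n23,
      n24, n25, n26, n27, ?_, ?_, n30, ?_, n32, n33, ?_, ?_, n36, n37, n38, n39, n40, ?_⟩
    · rw [hE]; exact n5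
    · show (constsQ8 M).eps2 * Real.exp (5 * (constsQ8 M).κ) ≤ 1
      rw [hE]; exact n10
    · rw [hE]; exact n13
    · show B13Step237.memberF (constsQ8 M) _ ≤ 1 / 2
      rw [hmem]; exact n19
    · show B13Step237.bracketF (constsQ8 M) _ * Real.exp (5 * ((1 - 7 * (constsQ8 M).δ) * _ * (constsQ8 M).κ)) ≤ (constsQ8 M).α₆
      rw [hbr]; exact n20
    · rw [hbr, hCE]; exact n28
    · rw [hCE]; exact n29
    · rw [hCE]; exact n31
    · show (constsQ8 M).A₂ * (constsQ8 M).C3act * (constsQ8 M).ε₁ ≤ (constsQ8 M).E₀ / 2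
      rw [mul_assoc, hCE, ← mul_assoc]; exact n34
    · show κw + 1 ≤ 1 * M; linarith
    · intro d hd
      rw [hI d]
      exact n41 d hd

/- CROSS-CHECK (an `example`, nothing declared — the statement IS `B13ChainJointNonvacuity.chain_joint_nonvacuous`, which stays the
declaration of record): n10-b's `∃`-statement re-obtained from the family at the member `M = κw + 1`, so `constsQ8_spec` has EXACTLY the
shape of its 69 conjuncts. -/
example : ∃ c : B13.Consts,
    (c.q = 8 ∧ R12 c ∧ 11 / 3 ≤ c.κ₁ ∧ 1 + 4 * Real.log 162 ≤ c.κ₁ ∧ 64 * Real.log 162 ≤ c.δ * c.κ ∧ 1 ≤ c.M ∧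
      0 < c.E₀ ∧ 0 < c.ε₁ ∧ 0 < c.C₁ ∧ 0 < c.α₄ ∧ 0 ≤ c.C₃ ∧
      27 * 1 * c.C₁ ^ 3 * Real.exp (49 * c.κ₁ - 1) ≤ c.C₃ * Real.exp (c.C₂ * c.κ₁)) ∧
    (c.L = 8 ∧ 12 ≤ c.L * 2 ∧ kappa₀ 64 8 ≤ c.κ ∧ kappa₀ 64 8 ≤ c.δ * c.κ ∧ 0 ≤ c.κ ∧
      c.δ < 1 ∧ 1 ≤ c.δ * c.κ ∧
      1 + 2 * Real.log (8 * 12 ^ 3) ≤ c.κ₁ ∧ 2 + 16 * Real.log 128 ≤ c.κ₁ ∧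
      10 * Real.exp (-1) ≤ c.δ₀ * c.M ∧ 2 * Real.log 5 ≤ c.δ₀ * c.M ∧
      (1 - c.δ) * c.κ ≤ (1 / 4) * (c.κ₁ - 1) ∧ (1 - 2 * c.δ) * c.κ ≤ (1 / 16) * c.κ₁ ∧
      0 < c.E₀ * c.ε₁ * c.C₁ * c.M ^ c.q * Real.exp (c.C₂ * c.κ₁) ∧ 0 ≤ c.ε₁ ∧ 0 ≤ c.C₃) ∧
    (8 ≤ c.L ∧ 0 < (1 : ℕ) ∧ 0 < c.ε₁ ∧ 0 < c.α₆ ∧ 0 ≤ c.eps2 ∧ 0 ≤ c.δ ∧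
      0 ≤ 1 - 7 * c.δ ∧ 0 ≤ c.κ ∧ 0 ≤ aw ∧
      c.R15 ∧ 18 * ((1 - 4 * c.δ) * c.κ) ≤ aw / 20 ∧ 4 * c.κ ≤ aw / 20 ∧
      Real.exp (-(aw / 20)) ≤ c.eps2 ∧
      2 * (4 : ℝ) * ((1 : ℕ) : ℝ) ^ 4 * Real.exp (-(aw / 10)) ≤ aw / 20 ∧
      0 ≤ (1 : ℝ) ∧ kappa₀ 64 8 + 1 ≤ c.δ * c.κ ∧ c.α₆ * Real.exp 1 * K₀ 64 8 * 64 ≤ 1 ∧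
      Real.exp (-(aw / 20)) * 64 ≤ c.δ * c.κ ∧
      B13Step237.R18half c (K₀ 64 8 * Real.exp (Real.exp (-(aw / 20)) * 64)) ∧
      B13Step237.R18sharp c (K₀ 64 8 * Real.exp (Real.exp (-(aw / 20)) * 64)) ((c.L : ℝ) / 2) ∧
      0 ≤ (1 : ℝ) ∧ kappa₀ 64 8 + 1 ≤ c.δ * ((c.L : ℝ) / 2) * c.κ ∧
      c.α₆ * Real.exp 1 * K₀ 64 8 * 64 ≤ 1 ∧
      18 * ((1 - 7 * c.δ) * ((c.L : ℝ) / 2) * c.κ) ≤ (c.κ₁ - 1) / 2 ∧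
      (0 : ℝ) ≤ 1 / 2 ∧ 1 / 2 + Real.exp (-((c.κ₁ - 1) / 2)) ≤ 1 ∧ 1 * 64 ≤ c.δ * ((c.L : ℝ) / 2) * c.κ ∧
      B13Step237.bracketF c (K₀ 64 8 * Real.exp (Real.exp (-(aw / 20)) * 64)) / c.α₆ * Real.exp (1 * 64) ≤
        c.C3act * c.ε₁ ∧
      0 ≤ c.C3act * c.ε₁ ∧
      c.κ + 2 * (64 * Real.log 162) + 2 ≤ (1 - 8 * c.δ) * ((c.L : ℝ) / 2) * c.κ ∧
      c.C3act * c.ε₁ * Real.exp (5 * c.κ + 1) * K₀ 64 8 * 9 * 64 ≤ 1 ∧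
      Real.exp 1 * 9 * 64 * K₀ 64 8 ^ 2 ≤ c.A₂ ∧ c.R22 ∧ c.R23 ∧ c.R24sharp ∧ 0 ≤ c.E₀ ∧
      0 ≤ (1 / 64 : ℝ) ∧ 1 / 64 * 64 ≤ c.E₀ / 2 ∧
      (0 : ℝ) < 1 / 2 ∧ 1 ≤ c.κ₁ ∧
      (∀ d : ℝ, 0 ≤ d → 0 < invTau c d ∧ invTau c d ≤ 1 / 2)) :=
  ⟨constsQ8 (κw + 1), constsQ8_spec le_rfl⟩

/-- **The junction's `hN` shape on the family**: `Lemma3Numerics (constsQ8 M) 1 (L∕2) aw 1 1 ½ 1` (bond-cube side 1, transfer factor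
`ℓ = L∕2 = 4`, rate `aw`, `a₂ = a₂′ = 1`, `a₅ = ½`, `Aabs = 1`), packaged from (C) exactly as `B13NodeTorusFamilyNonvacuity.numerics_consts`
packages the base witness. [cite: Balaban1988RG2Cluster, pp.17–20 (restrictions on the constants), p.21 (closing paragraph)] -/
theorem constsQ8_numerics {M : ℝ} (hM : κw + 1 ≤ M) :
    Lemma3Numerics (constsQ8 M) 1 (((constsQ8 M).L : ℝ) / 2) aw 1 1 (1 / 2) 1 := by
  obtain ⟨-, -, ⟨-, -, -, hα₆, heps2, hδ, hδ7, hκ, ha, hR15, hR16, hR16', hR17, h231, ha₂, hκ229, hsm229, habsk, h18half, h18,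
    ha₂', hκ229', hsm229', hR20, ha₅, habs, hAc, hC3, -⟩⟩ := constsQ8_spec hM
  have hℓ : (0 : ℝ) ≤ ((constsQ8 M).L : ℝ) / 2 := by positivity
  exact ⟨hℓ, hα₆, heps2, hδ, hδ7, hκ, ha, hR15, hR16, hR16', hR17, h231, ha₂, hκ229, hsm229, habsk, h18half, h18, ha₂', hκ229',
    hsm229', hR20, ha₅, habs, hAc, hC3⟩

/-- **The junction's `hτ2` shape on the family**: `E₀ε₁C₁α₄⁻¹M^q e^{C₂κ₁} ≤ ½` — the (2.18) bound `1∕|τ| ≤ ½` of (C) read at tree distance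
`d = 0`. [cite: Balaban1988RG2Cluster, (2.18) p.16] -/
theorem constsQ8_invTau_zero {M : ℝ} (hM : κw + 1 ≤ M) :
    (constsQ8 M).E₀ * (constsQ8 M).ε₁ * (constsQ8 M).C₁ * (constsQ8 M).α₄⁻¹ * (constsQ8 M).M ^ (constsQ8 M).q *
        Real.exp ((constsQ8 M).C₂ * (constsQ8 M).κ₁) ≤ 1 / 2 := by
  obtain ⟨-, -, hC⟩ := constsQ8_spec hM
  have h := (hC.2.2.2.2.2.2.2.2.2.2.2.2.2.2.2.2.2.2.2.2.2.2.2.2.2.2.2.2.2.2.2.2.2.2.2.2.2.2.2.2 0 le_rfl).2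
  unfold invTau at h
  simpa only [mul_zero, Real.exp_zero, mul_one] using h

/-! ## §2. THE JOINT WITNESS: chain numerics ∧ the (2.24)–(2.26) located numerals ∧ the p. 17 constant matching, at ONE record -/

/-- **JOINT NON-VACUITY OF THE N10 CHAIN WITH THE (2.24)–(2.26) LOCATED NUMERALS AND (2.22)'s `a ≤ γ₂r_P²`.**  For EVERY `m ν m′ : ℕ` and
EVERY signed choice of the NODE-A letters (`κ⋆ > 0`, `K_G, K_Cs, c_E, c_V, c₀η ≥ 0`, `m_A > 0`) there are ONE constants record `c`
(`constsQ8 (κw + 1 + M⁴min)`), ONE `θ₀` (`θ₀max`), ONE `γ₂` (`γ₂max`) and ONE non-zero real coupling `g` (`ε₁∕√(aw∕γ₂)`, i.e.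
`r_P = ε₁∕‖g‖ = √(aw∕γ₂)`) meeting SIMULTANEOUSLY: the chain's 69 numerical conjuncts (print's `q = 8`, R12); the junction's `hN`
(`Lemma3Numerics c 1 (c.L∕2) aw 1 1 ½ 1`) and `hτ2`; the three located numerals `0 < θ₀ ≤ θ₀max`, `0 < γ₂ ≤ γ₂max`, `M⁴min(…, c.α₄, c.κ₁)
≤ c.M⁴` with `1 ≤ c.M`, `0 < c.α₄`; the constant matching `aw ≤ γ₂·(c.ε₁∕‖g‖)²` with `g ≠ 0`; and hence the eleven junction binder shapes
`hkap'' hk1 hk2 hk3 hk4 hθ₀le hθR1le hsmallKθ hc0 hαc hsmall` on the canonical chain AT THE RECORD'S OWN `α₄, M, κ₁`.  Consistency of typed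
inequality lists; nothing about Bałaban's constants. [cite: Balaban1988RG2Cluster, p.16 (after (2.18)), (2.22) p.16, (2.24)-(2.25) p.17, p.21 (closing paragraph)] -/
theorem chain_joint_nonvacuous_226 (m ν m' : ℕ) {κs KG KCs cE BΓ cV c0η mA : ℝ} (hκ : 0 < κs) (hKG : 0 ≤ KG)
    (hKCs : 0 ≤ KCs) (hcE : 0 ≤ cE) (hcV : 0 ≤ cV) (hc0 : 0 ≤ c0η) (hmA : 0 < mA) :
    ∃ (c : B13.Consts) (θ₀ γ₂ g : ℝ),
      -- the 69 conjuncts of the chain, verbatim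
      ((c.q = 8 ∧ R12 c ∧ 11 / 3 ≤ c.κ₁ ∧ 1 + 4 * Real.log 162 ≤ c.κ₁ ∧ 64 * Real.log 162 ≤ c.δ * c.κ ∧ 1 ≤ c.M ∧
          0 < c.E₀ ∧ 0 < c.ε₁ ∧ 0 < c.C₁ ∧ 0 < c.α₄ ∧ 0 ≤ c.C₃ ∧
          27 * 1 * c.C₁ ^ 3 * Real.exp (49 * c.κ₁ - 1) ≤ c.C₃ * Real.exp (c.C₂ * c.κ₁)) ∧
        (c.L = 8 ∧ 12 ≤ c.L * 2 ∧ kappa₀ 64 8 ≤ c.κ ∧ kappa₀ 64 8 ≤ c.δ * c.κ ∧ 0 ≤ c.κ ∧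
          c.δ < 1 ∧ 1 ≤ c.δ * c.κ ∧
          1 + 2 * Real.log (8 * 12 ^ 3) ≤ c.κ₁ ∧ 2 + 16 * Real.log 128 ≤ c.κ₁ ∧
          10 * Real.exp (-1) ≤ c.δ₀ * c.M ∧ 2 * Real.log 5 ≤ c.δ₀ * c.M ∧
          (1 - c.δ) * c.κ ≤ (1 / 4) * (c.κ₁ - 1) ∧ (1 - 2 * c.δ) * c.κ ≤ (1 / 16) * c.κ₁ ∧
          0 < c.E₀ * c.ε₁ * c.C₁ * c.M ^ c.q * Real.exp (c.C₂ * c.κ₁) ∧ 0 ≤ c.ε₁ ∧ 0 ≤ c.C₃) ∧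
        (8 ≤ c.L ∧ 0 < (1 : ℕ) ∧ 0 < c.ε₁ ∧ 0 < c.α₆ ∧ 0 ≤ c.eps2 ∧ 0 ≤ c.δ ∧
          0 ≤ 1 - 7 * c.δ ∧ 0 ≤ c.κ ∧ 0 ≤ aw ∧
          c.R15 ∧ 18 * ((1 - 4 * c.δ) * c.κ) ≤ aw / 20 ∧ 4 * c.κ ≤ aw / 20 ∧
          Real.exp (-(aw / 20)) ≤ c.eps2 ∧
          2 * (4 : ℝ) * ((1 : ℕ) : ℝ) ^ 4 * Real.exp (-(aw / 10)) ≤ aw / 20 ∧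
          0 ≤ (1 : ℝ) ∧ kappa₀ 64 8 + 1 ≤ c.δ * c.κ ∧ c.α₆ * Real.exp 1 * K₀ 64 8 * 64 ≤ 1 ∧
          Real.exp (-(aw / 20)) * 64 ≤ c.δ * c.κ ∧
          B13Step237.R18half c (K₀ 64 8 * Real.exp (Real.exp (-(aw / 20)) * 64)) ∧
          B13Step237.R18sharp c (K₀ 64 8 * Real.exp (Real.exp (-(aw / 20)) * 64)) ((c.L : ℝ) / 2) ∧
          0 ≤ (1 : ℝ) ∧ kappa₀ 64 8 + 1 ≤ c.δ * ((c.L : ℝ) / 2) * c.κ ∧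
          c.α₆ * Real.exp 1 * K₀ 64 8 * 64 ≤ 1 ∧
          18 * ((1 - 7 * c.δ) * ((c.L : ℝ) / 2) * c.κ) ≤ (c.κ₁ - 1) / 2 ∧
          (0 : ℝ) ≤ 1 / 2 ∧ 1 / 2 + Real.exp (-((c.κ₁ - 1) / 2)) ≤ 1 ∧ 1 * 64 ≤ c.δ * ((c.L : ℝ) / 2) * c.κ ∧
          B13Step237.bracketF c (K₀ 64 8 * Real.exp (Real.exp (-(aw / 20)) * 64)) / c.α₆ * Real.exp (1 * 64) ≤
            c.C3act * c.ε₁ ∧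
          0 ≤ c.C3act * c.ε₁ ∧
          c.κ + 2 * (64 * Real.log 162) + 2 ≤ (1 - 8 * c.δ) * ((c.L : ℝ) / 2) * c.κ ∧
          c.C3act * c.ε₁ * Real.exp (5 * c.κ + 1) * K₀ 64 8 * 9 * 64 ≤ 1 ∧
          Real.exp 1 * 9 * 64 * K₀ 64 8 ^ 2 ≤ c.A₂ ∧ c.R22 ∧ c.R23 ∧ c.R24sharp ∧ 0 ≤ c.E₀ ∧
          0 ≤ (1 / 64 : ℝ) ∧ 1 / 64 * 64 ≤ c.E₀ / 2 ∧
          (0 : ℝ) < 1 / 2 ∧ 1 ≤ c.κ₁ ∧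
          (∀ d : ℝ, 0 ≤ d → 0 < invTau c d ∧ invTau c d ≤ 1 / 2))) ∧
      -- the junction's `hN` and `hτ2`
      Lemma3Numerics c 1 ((c.L : ℝ) / 2) aw 1 1 (1 / 2) 1 ∧
      c.E₀ * c.ε₁ * c.C₁ * c.α₄⁻¹ * c.M ^ c.q * Real.exp (c.C₂ * c.κ₁) ≤ 1 / 2 ∧
      -- the three located numerals of `B13Bound226Numerals` at the record's own `α₄, M, κ₁`
      (0 < θ₀ ∧ θ₀ ≤ theta0Max m ν κs KG KCs cE BΓ cV c0η mA) ∧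
      (0 < γ₂ ∧ γ₂ ≤ gamma2Max m ν cE BΓ cV c0η mA) ∧
      (1 ≤ c.M ∧ 0 < c.α₄ ∧ m4Min m ν m' cE BΓ cV c0η mA c.α₄ c.κ₁ ≤ c.M ^ 4) ∧
      -- the p. 17 constant matching `a ≤ γ₂ r_P²` at `r_P = ε₁/‖g‖`, a non-zero coupling
      (g ≠ 0 ∧ 0 < c.ε₁ / ‖g‖ ∧ aw ≤ γ₂ * (c.ε₁ / ‖g‖) ^ 2) ∧
      -- hence: the eleven binder shapes of the junction on the canonical chain
      (0 < chainRate 1 κs ∧ chainRate 1 κs < chainRate 2 κs ∧ chainRate 2 κs < chainRate 3 κs ∧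
        chainRate 3 κs < chainRate 4 κs ∧ chainRate 4 κs < κs ∧
        θ₀ ≤ theta m ν κs KG KCs θ₀ ∧
        ((m : ℝ) * (1 + 2 / (chainRate 3 κs - chainRate 2 κs)) ^ ν) * ((m : ℝ) * (1 + 2 / (chainRate 2 κs - chainRate 1 κs)) ^ ν)
          * (θ₀ * KCs * KG
            + KG * (KCs * θ₀ * ((m : ℝ) * (1 + 2 / (κs - chainRate 4 κs)) ^ ν) * KCs
                * ((m : ℝ) * (1 + 2 / (chainRate 4 κs - chainRate 3 κs)) ^ ν)) * KG
            + KG * KCs * θ₀)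
          ≤ theta m ν κs KG KCs θ₀ ∧
        KCs * ((m : ℝ) * (1 + 2 / chainRate 3 κs) ^ ν) * (theta m ν κs KG KCs θ₀ * ((m : ℝ) * (1 + 2 / chainRate 1 κs) ^ ν))
          < 1 ∧
        0 ≤ cE ∧
        (2 * (theta m ν κs KG KCs θ₀ * ((m : ℝ) * (1 + 2 / chainRate 1 κs) ^ ν))
            + (γ₂ + 2 * ((m' : ℝ) * c.α₄ * (c.M ^ 4)⁻¹ * (1 + 32 / (c.κ₁ - 1)) ^ 4))) * cE ≤ 1 / 2 ∧
        (2 * (theta m ν κs KG KCs θ₀ * ((m : ℝ) * (1 + 2 / chainRate 1 κs) ^ ν))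
            + (γ₂ + 2 * ((m' : ℝ) * c.α₄ * (c.M ^ 4)⁻¹ * (1 + 32 / (c.κ₁ - 1)) ^ 4)))
          * (1 + 2 * cE * (BΓ * cV * (BΓ * ((m : ℝ) * c0η ^ ν)) / (mA / 2))) ≤ 1 / 2) := by
  -- the witness record: the family member with `M := κw + 1 + M⁴min(letters; α₄ = 1, κ₁ = κ₁t)`
  set X := m4Min m ν m' cE BΓ cV c0η mA 1 κ₁t with hX_def
  have hX : 0 ≤ X := m4Min_nonneg m ν m' (BΓ := BΓ) (κ₁ := κ₁t) hcE hcV hc0 hmA zero_le_one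
  have hκw0 := κw_lower.1
  have hM : κw + 1 ≤ κw + 1 + X := by linarith
  have hM1 : (1 : ℝ) ≤ κw + 1 + X := by linarith
  have hspec := constsQ8_spec hM
  -- the located numerals
  have hθ := theta0Max_pos m ν (KG := KG) (BΓ := BΓ) hκ hKCs hcE hcV hc0 hmA
  have hγ := gamma2Max_pos m ν (BΓ := BΓ) hcE hcV hc0 hmA
  set θ₀ := theta0Max m ν κs KG KCs cE BΓ cV c0η mA with hθ₀_def
  set γ₂ := gamma2Max m ν cE BΓ cV c0η mA with hγ₂_def
  -- `M⁴min ≤ M⁴` at the record's own `α₄ = 1`, `κ₁ = κ₁t`: `X ≤ 1 + X ≤ (κw + 1 + X)⁴`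
  have hM4 : m4Min m ν m' cE BΓ cV c0η mA (constsQ8 (κw + 1 + X)).α₄ (constsQ8 (κw + 1 + X)).κ₁ ≤
      (constsQ8 (κw + 1 + X)).M ^ 4 := by
    show X ≤ (κw + 1 + X) ^ 4
    have h1 : κw + 1 + X ≤ (κw + 1 + X) ^ 4 := by
      calc κw + 1 + X = (κw + 1 + X) ^ 1 := (pow_one _).symm
        _ ≤ (κw + 1 + X) ^ 4 := pow_le_pow_right₀ hM1 (by norm_num)
    linarith
  -- the coupling letter: `g := ε₁/√(aw/γ₂)`, so that `r_P = ε₁/‖g‖ = √(aw/γ₂)` and `γ₂ r_P² = aw`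
  have hε₁ : 0 < (constsQ8 (κw + 1 + X)).ε₁ := constsQ8_ε₁_pos (by linarith)
  have haw : 0 < aw := aw_pos
  have hs : 0 < Real.sqrt (aw / γ₂) := Real.sqrt_pos.2 (div_pos haw hγ)
  set s := Real.sqrt (aw / γ₂) with hs_def
  have hg : 0 < (constsQ8 (κw + 1 + X)).ε₁ / s := div_pos hε₁ hs
  have hrP : (constsQ8 (κw + 1 + X)).ε₁ / ‖(constsQ8 (κw + 1 + X)).ε₁ / s‖ = s := by
    rw [Real.norm_of_nonneg hg.le]; field_simp
  have hPa : aw ≤ γ₂ * ((constsQ8 (κw + 1 + X)).ε₁ / ‖(constsQ8 (κw + 1 + X)).ε₁ / s‖) ^ 2 := by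
    rw [hrP, hs_def, Real.sq_sqrt (div_pos haw hγ).le]
    field_simp
    exact le_rfl
  refine ⟨constsQ8 (κw + 1 + X), θ₀, γ₂, (constsQ8 (κw + 1 + X)).ε₁ / s, hspec, constsQ8_numerics hM, constsQ8_invTau_zero hM,
    ⟨hθ, le_rfl⟩, ⟨hγ, le_rfl⟩, ⟨hM1, by show (0 : ℝ) < 1; norm_num, hM4⟩, ⟨hg.ne', by rw [hrP]; exact hs, hPa⟩, ?_⟩
  exact numerals_226 m ν m' hκ hKG hKCs hθ.le hcE hcV hc0 hmA hγ.le (by show (0 : ℝ) ≤ 1; norm_num) hM1 le_rfl le_rfl hM4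

end Literature.MathematicalPhysics.QuantumFieldTheory.Balaban1983to89.B13ChainJointNonvacuity226

end
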